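import Summits.QuantumFields.YangMills.Theorems.AtomicCalibrationRMirrorCalibration

/-!
# Leaf `HypercubicOSDataFromInfiniteVolume` (stmt-QuantumFields-19868), stub CAL `stub_temperedCalibrationK` — part 2/3: the FINE atom-scale regime
# with the TEMPERED two-point ceiling

`AtomicCalibrationR.MirrorCalibration.rpSquare_le_fine` (planner ym-idea-11 g15, B6) VERBATIM with the inherited two-point ceiling `(C/R⁴)²` replaced by the
tempered one `(C/R⁴)²·(ℓ₄/(R α))^M` of LINE «TemperedPeak»'s currency E_T (`PinnedTemperedCeiling`): since the separation radius is `R = ⌊δ/s⌋₊ − 3 ≥ δ/(2s)`,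
the tempering costs exactly `(ℓ₄/(Rα))^M ≤ (2ℓ₄/δ)^M · (s/α)^M` — the level of TAC-K (`TemperedAtomCeilingsK`) at the atom's own scale `s`:
`rpSquare ≤ Mb² C² (4(t+δ)/δ)⁸ · (2ℓ₄/δ)^M · (s/α)^M`.

Atom geometry only (credit: the B6 file); no stub/crux/rung/leaf/summit is closed by THIS file; the Yang–Mills mass gap is NOT proved. [folklore]
-/

set_option autoImplicit false

noncomputable section

open scoped BigOperators
open MeasureTheory Filter Topology
open Literature.MathematicalPhysics.QuantumFieldTheory Literature.MathematicalPhysics.QuantumLattice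
open Literature.Probability.LatticeModels (Site)
open Summit.QuantumFields.YangMills.Theorems.InfiniteVolume (stateMomentStr measurable_plane
  abs_integral_centred_prod_le_of_eventually eventually_torusSeparated eventually_le_of_strictMono)
open Summit.QuantumFields.YangMills.Theorems.InfVolRP (centreOffset centreOffset_time norm_centreOffset_le_one)
open Summit.QuantumFields.YangMills.Theorems.OnsetTautologyOnsetContraction (stateMomentStr_two abs_centredPlane_le
  abs_coord_le_of_ne_zero)
open Summit.QuantumFields.YangMills.Theses.OnsetTautology (AdmissibleAtomProfile)
open Summit.QuantumFields.YangMills.Cruxes.OSLegsFromFemtoAndGap.DlrCollarTransfer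
open Summit.QuantumFields.YangMills.Cruxes.AtomicCalibrationR.MirrorCalibration

namespace Summit.QuantumFields.YangMills.Cruxes.HypercubicOSDataFromInfiniteVolume.TemperedCalibration

variable {G : Type} [Group G] [TopologicalSpace G] [IsTopologicalGroup G] [CompactSpace G]
  [MeasurableSpace G] [BorelSpace G]

omit [IsTopologicalGroup G] [CompactSpace G] [BorelSpace G] in
/-- FINE REGIME, TEMPERED (`rpSquare_le_fine` of the B6 file with the two-point ceiling `(C/R⁴)²·(ℓ₄/(Rα))^M`): `K α < s ≤ δ/8` (α = the unit at this β, `K ≥ δ/ℓ₄`): with `R = ⌊δ/s⌋₊ − 3` every (reflected,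
direct) pair is `(2R+4)`-separated in time, `1 ≤ R`, `R α ≤ ℓ₄`, so each pair is bounded by the inherited ceiling
`(C/R⁴)²`; the `s⁻⁸` pair count is compensated by the `R⁻⁸` decay: `rpSquare ≤ Mb² C² (4(t+δ)/δ)⁸`. -/
theorem rpSquare_le_fine_tempered (r : LatticeRep G) (μ : Measure (LGConfig 4 G))
    {b : SchwartzMap (EuclideanSpace ℝ (Fin 4)) ℝ} {t δ Mb C ℓ₄ α K : ℝ} {M : ℕ}
    (hbt : Function.support (b : EuclideanSpace ℝ (Fin 4) → ℝ) ⊆ Metric.closedBall 0 t) (ht0 : 0 < t)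
    (hδpos : 0 < δ) (hδ : ∀ u, b u ≠ 0 → δ ≤ u 0) (hMb : ∀ u, |b u| ≤ Mb)
    (hα : 0 < α) (hℓ₄ : 0 < ℓ₄) (hKpos : 0 < K) (hKδ : δ / ℓ₄ ≤ K)
    (hceilμ : ∀ (R : ℕ), 1 ≤ R → (R : ℝ) * α ≤ ℓ₄ → ∀ (q q' : Fin 4 × Fin 4) (x y : Fin 4 → ℤ),
      q.1 < q.2 → q'.1 < q'.2 → (∃ k : Fin 4, (2 * (R : ℤ) + 4) ≤ |x k - y k|) →
      |stateMomentStr G r μ 2 ![q, q'] ![x, y]| ≤ (C / (R : ℝ) ^ 4) ^ 2 * (ℓ₄ / ((R : ℝ) * α)) ^ M)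
    {s : ℝ} (hs0 : 0 < s) (hreg : s ≤ δ / 8) (hlt : K * α < s) {y : EuclideanSpace ℝ (Fin 4)}
    (hy : ∀ i, 0 ≤ y i ∧ y i ≤ s) (q : Fin 4 × Fin 4) :
    rpSquare r μ b {q} s y ≤ Mb ^ 2 * (C ^ 2 * (4 * (t + δ) / δ) ^ 8) * ((2 * ℓ₄ / δ) ^ M * (s / α) ^ M) := by
  have hs0' : s ≠ 0 := hs0.ne'
  have hδ0 : δ ≠ 0 := hδpos.ne'
  have hB : t / s + 3 ≤ ((⌈t / s⌉₊ + 3 : ℕ) : ℝ) := by push_cast; linarith [Nat.le_ceil (t / s)]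
  have hcar := atom_subset_carrier hbt hs0 hy q hB
  -- the separation radius `R = ⌊δ/s⌋₊ − 3`
  have h8 : (8 : ℝ) ≤ δ / s := by rw [le_div_iff₀ hs0]; linarith
  have hm8 : 8 ≤ ⌊δ / s⌋₊ := Nat.le_floor (by exact_mod_cast h8)
  have hfl : (⌊δ / s⌋₊ : ℝ) ≤ δ / s := Nat.floor_le (by positivity)
  obtain ⟨R, hR1, hRle, hRge⟩ : ∃ R : ℕ, 1 ≤ R ∧ (R : ℝ) ≤ δ / s - 3 ∧ δ / s - 4 ≤ (R : ℝ) := by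
    refine ⟨⌊δ / s⌋₊ - 3, by omega, ?_, ?_⟩
    · rw [Nat.cast_sub (by omega)]; push_cast; linarith
    · rw [Nat.cast_sub (by omega)]; push_cast; linarith [Nat.lt_floor_add_one (δ / s)]
  have hRlow : δ / (2 * s) ≤ (R : ℝ) := by
    have : δ / (2 * s) = (δ / s) / 2 := by rw [div_div, mul_comm]
    rw [this]; linarith
  -- `R · α ≤ ℓ₄`
  have hRa : (R : ℝ) * α ≤ ℓ₄ := by
    have h1 : (R : ℝ) * α ≤ δ / s * α := mul_le_mul_of_nonneg_right (by linarith) hα.le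
    have h2 : δ / s * α ≤ δ / K := by
      have : δ / s * α = (δ / K) * ((K * α) / s) := by field_simp
      rw [this]
      exact mul_le_of_le_one_right (by positivity) ((div_le_one hs0).2 hlt.le)
    have h3 : δ / K ≤ ℓ₄ := by
      rw [div_le_iff₀ hKpos]
      have := hKδ; rw [div_le_iff₀ hℓ₄] at this; linarith
    linarith
  -- the pair bound: (reflected plaquette, direct plaquette) pairs are `(2R+4)`-separated in time
  have hpair : ∀ p p' : (Fin 4 × Fin 4) × (Fin 4 → ℤ), atomWr b {q} s y p ≠ 0 → atomWt b {q} s y p' ≠ 0 →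
      |stateMomentStr G r μ 2 ![p.1, p'.1] ![p.2, p'.2]| ≤ (C / (R : ℝ) ^ 4) ^ 2 * (ℓ₄ / ((R : ℝ) * α)) ^ M := by
    intro p p' hp hp'
    have hq1 := (atomWr_ne_zero_iff b {q} s y p).1 hp
    have hq2 := (atomWt_ne_zero_iff b {q} s y p').1 hp'
    refine hceilμ R hR1 hRa p.1 p'.1 p.2 p'.2 hq1.1.2 hq2.1.2 ⟨0, ?_⟩
    have hlo := time_floor_of_wt hδ hs0 (hy 0).1 p'.1 p'.2 hq2.2
    have hhi := time_ceiling_of_wr hδ hs0 (hy 0).1 p.1 p.2 hq1.2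
    have hreal : (2 * (R : ℝ) + 4) ≤ ((p'.2 0 : ℤ) : ℝ) - ((p.2 0 : ℤ) : ℝ) := by linarith
    have hint : (2 * (R : ℤ) + 4) ≤ p'.2 0 - p.2 0 := by exact_mod_cast hreal
    rw [abs_sub_comm]
    exact hint.trans (le_abs_self _)
  have hbound := rpSquare_le_of_pairBound r μ b q s y (carrier q (⌈t / s⌉₊ + 3)) (fun p hp => (hcar p).1 hp)
    (fun p hp => (hcar p).2 hp) hMb (by positivity) hpair
  rw [card_carrier] at hbound
  push_cast at hbound
  -- `#S ≤ ((2t+2δ)/s)⁴` and `(C/R⁴)² ≤ C² (2s/δ)⁸`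
  have hcardR : (2 * ((⌈t / s⌉₊ : ℝ) + 3) + 1) ^ 4 ≤ ((2 * t + 2 * δ) / s) ^ 4 := by
    have hB' : (⌈t / s⌉₊ : ℝ) < t / s + 1 := Nat.ceil_lt_add_one (by positivity)
    have h9 : (9 : ℝ) ≤ 2 * δ / s := by rw [le_div_iff₀ hs0]; linarith
    have hsum : (2 * t + 2 * δ) / s = 2 * (t / s) + 2 * δ / s := by ring
    exact pow_le_pow_left₀ (by positivity) (by rw [hsum]; linarith) 4
  have hdecay : (C / (R : ℝ) ^ 4) ^ 2 ≤ C ^ 2 * (2 * s / δ) ^ 8 := by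
    have hRpos : (0 : ℝ) < R := by exact_mod_cast hR1
    have h1 : (C / (R : ℝ) ^ 4) ^ 2 = C ^ 2 / (R : ℝ) ^ 8 := by rw [div_pow, ← pow_mul]
    have h2 : (δ / (2 * s)) ^ 8 ≤ (R : ℝ) ^ 8 := pow_le_pow_left₀ (by positivity) hRlow 8
    have h3 : C ^ 2 / (R : ℝ) ^ 8 ≤ C ^ 2 / (δ / (2 * s)) ^ 8 :=
      div_le_div_of_nonneg_left (sq_nonneg C) (by positivity) h2
    have h4 : C ^ 2 / (δ / (2 * s)) ^ 8 = C ^ 2 * (2 * s / δ) ^ 8 := by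
      rw [← inv_div (2 * s) δ, inv_pow, div_inv_eq_mul]
    calc (C / (R : ℝ) ^ 4) ^ 2 = C ^ 2 / (R : ℝ) ^ 8 := h1
      _ ≤ C ^ 2 / (δ / (2 * s)) ^ 8 := h3
      _ = C ^ 2 * (2 * s / δ) ^ 8 := h4
  have hprod : (((2 * t + 2 * δ) / s) ^ 4) ^ 2 * (2 * s / δ) ^ 8 = (4 * (t + δ) / δ) ^ 8 := by
    rw [← pow_mul, show 4 * 2 = 8 by norm_num, ← mul_pow]
    congr 1
    field_simp
    ring
  -- the tempering factor at `R ≥ δ/(2s)`: `(ℓ₄/(Rα))^M ≤ (2ℓ₄/δ)^M (s/α)^M`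
  have htemp : (ℓ₄ / ((R : ℝ) * α)) ^ M ≤ (2 * ℓ₄ / δ) ^ M * (s / α) ^ M := by
    rw [← mul_pow]
    refine pow_le_pow_left₀ (by positivity) ?_ M
    have hRα : δ / (2 * s) * α ≤ (R : ℝ) * α := mul_le_mul_of_nonneg_right hRlow hα.le
    have hpos : 0 < δ / (2 * s) * α := by positivity
    calc ℓ₄ / ((R : ℝ) * α) ≤ ℓ₄ / (δ / (2 * s) * α) := div_le_div_of_nonneg_left hℓ₄.le hpos hRα
      _ = 2 * ℓ₄ / δ * (s / α) := by field_simp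
  have htemp0 : 0 ≤ (ℓ₄ / ((R : ℝ) * α)) ^ M := by positivity
  calc rpSquare r μ b {q} s y
      ≤ ((2 * ((⌈t / s⌉₊ : ℝ) + 3) + 1) ^ 4) ^ 2 * Mb ^ 2 * ((C / (R : ℝ) ^ 4) ^ 2 * (ℓ₄ / ((R : ℝ) * α)) ^ M) := hbound
    _ ≤ (((2 * t + 2 * δ) / s) ^ 4) ^ 2 * Mb ^ 2 * ((C ^ 2 * (2 * s / δ) ^ 8) * ((2 * ℓ₄ / δ) ^ M * (s / α) ^ M)) := by
        gcongr
    _ = Mb ^ 2 * (C ^ 2 * ((((2 * t + 2 * δ) / s) ^ 4) ^ 2 * (2 * s / δ) ^ 8)) * ((2 * ℓ₄ / δ) ^ M * (s / α) ^ M) := by ring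
    _ = Mb ^ 2 * (C ^ 2 * (4 * (t + δ) / δ) ^ 8) * ((2 * ℓ₄ / δ) ^ M * (s / α) ^ M) := by rw [hprod]

end Summit.QuantumFields.YangMills.Cruxes.HypercubicOSDataFromInfiniteVolume.TemperedCalibration

end
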